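import Mathlib
import Summits.NavierStokesRegularity.FluidComputer.WobblingBeltramiHost
import HarnessLib

/-!
# The inherited drift of a Beltrami pattern in uniform background rotation (INHERITED DRIFT LEMMA):
# exact solution, rigid drift `2Ω/λ̄` along the rotation axis, and absolute vorticity
# `= λ̄ × (co-moving velocity)`

HONEST FRAMING (cell `ns-blowup`, seat `ns-blowup-refuter`, human ruling D-0035): nothing here is a
claim about Navier–Stokes blow-up. WHAT THIS IS NOT: not a statement about the marginal tower N1*;
it is the kernel form of the refuter's INHERITED DRIFT LEMMA (`KILLSHEET.md` §XIX.9 (a), STATUS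
K-CHECK 12:08Z (3)), which tests the caveat of `instab/X1pp-SKENE-TOBIAS.md` §4 («a uniform
background VORTICITY inherited from level k−1 is not removable by Galilean covariance and lets a
Beltrami pattern propagate through the fluid as an inertial wave»).

In a frame rotating with angular velocity `Ω` the Coriolis acceleration is the body force
`−2Ω × u` (the centrifugal part is a gradient, absorbed in the pressure). For a smooth
divergence-free strong Beltrami pattern `U` (`curl U = λ̄U`) and a drift vector `c` with
`λ̄c = 2Ω`:

* §1 (`fderiv_apply_eq_cross_curl_add_gradient`) the directional derivative of any field along a
  constant vector is `DU(y)[c] = (curl U)(y) × c + ∇⟪c, U⟫(y)` (Majda–Bertozzi §1.1,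
  `∇(A·B) = (A·∇)B + (B·∇)A + A × curl B + B × curl A` with `A = c` constant).
* §2 **INHERITED DRIFT LEMMA, lab (rotating-frame) form** (`isClassicalNSSolutionOn_driftingHost`):
  `u(t, x) = U(x + tc)`, `p = −½|u|² − ⟪c, u⟫` is a classical solution on `ℝ³ × ℝ` of the
  Navier–Stokes system with force `νλ̄²u − 2Ω × u` = viscous maintenance + Coriolis. With `ν = 0`
  (`isClassicalEulerSolutionOn_driftingHost`) this is an exact solution of the ROTATING EULER
  equations: the Beltrami pattern translates RIGIDLY through the fluid with velocity `−c = −2Ω/λ̄`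
  (the non-dispersive inertial-wave translate of a single helical shell: for `U = Σ_{|k|=λ̄} û_k e^{ik·x}`
  of one helicity the phases are `e^{ik·(x + 2Ωt/λ̄)}`, i.e. the inertial-wave dispersion relation
  `ω_k = −2(k·Ω)/λ̄` restricted to the shell). So the memo's caveat is EXACT: an inherited uniform
  background rotation makes a level-`k` Beltrami pattern slip through the fluid at speed `2|Ω|/λ̄`
  (`~ σ_{k−1}ℓ_k`) with NO force — an unforced, steady analogue of the class-(II) wobble.
* §3 **… and why it opens no channel** (`absoluteVorticity_eq_smul_comovingVelocity`,
  `isClassicalNSSolutionOn_driftingHost_comoving`, `cross_coriolis_drift_eq_zero`): in the frame of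
  the drifting pattern (the tree's `galileanBoost` with frame path `ξ(t) = −tc`) the velocity is the
  STEADY field `V(y) = U(y) + c`, and the ABSOLUTE vorticity `curl u + 2Ω = λ̄U + λ̄c = λ̄V` is
  exactly `λ̄` times the co-moving velocity: the flow is Beltrami with respect to (absolute vorticity,
  co-moving velocity). Hence absolute vortex lines are the streamlines of the steady co-moving flow —
  they vanish at, and are tangent to the invariant manifolds of, its hyperbolic stagnation points —
  and the steady-host tangency lemma K21 (`StagnationPointIdentities`, R12′ S1/S3) applies verbatim:
  the adapted host term of the cell's DC-channel ledger (PENDING-RULINGS A7) vanishes at order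
  `ε_m⁰`. The Coriolis force is unchanged by the boost because `2Ω × c = λ̄ c × c = 0`
  (`cross_coriolis_drift_eq_zero`), so the co-moving system is forced by `νλ̄²U − 2Ω × V` exactly.

All statements are pointwise identities over the tree's `IsClassicalNSSolutionOn`, `IsBeltrami`,
`cross`, `curl`, `convect`, `gradient`, `galileanBoost`; no spectral claim. References:
Majda–Bertozzi 2002 §1.1, §2.3.2 (Beltrami flows); Greenspan 1968 §2 (inertial waves,
dispersion `ω = ∓2Ω·k/|k|`); cell files `KILLSHEET.md` §XIX.9, `instab/X1pp-SKENE-TOBIAS.md` §4.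
-/

noncomputable section

open Set Real InnerProductSpace
open scoped RealInnerProductSpace ContDiff Laplacian Topology

namespace Summit.NavierStokesRegularity.FluidComputer.InheritedDriftBeltramiHost

open Literature.Analysis.FluidPDE Literature.Analysis.FluidPDE.ABC BeltramiHostLinearisation
  BeltramiSextuplet WobblingBeltramiHost

/-! ### §1 Algebra: directional derivative along a constant vector; cross-product bookkeeping -/

/-- `DU(y)[c] = (curl U)(y) × c + ∇⟪c, U⟫(y)` for a constant vector `c` (the polarised Lamb
identity with one constant factor). -/
theorem fderiv_apply_eq_cross_curl_add_gradient
    {U : EuclideanSpace ℝ (Fin 3) → EuclideanSpace ℝ (Fin 3)} {y : EuclideanSpace ℝ (Fin 3)}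
    (hU : DifferentiableAt ℝ U y) (c : EuclideanSpace ℝ (Fin 3)) :
    fderiv ℝ U y c = cross (curl U y) c + gradient (fun z => ⟪c, U z⟫) y := by
  apply ext_inner_right ℝ
  intro h
  have h0 : fderiv ℝ (fun _ : EuclideanSpace ℝ (Fin 3) => c) y h = 0 := by simp
  rw [inner_add_left, inner_cross_curl_left, inner_gradient_left,
    fderiv_inner_apply ℝ (differentiableAt_const c) hU, h0, inner_zero_left, add_zero,
    real_inner_comm (fderiv ℝ U y c) h]
  ring

/-- `(λ̄a) × c = −(λ̄c) × a` (bilinearity and antisymmetry of the cross product). -/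
theorem cross_smul_left_eq_neg_cross_smul (lam : ℝ) (a c : EuclideanSpace ℝ (Fin 3)) :
    cross (lam • a) c = -cross (lam • c) a := by
  ext i
  fin_cases i <;> simp [cross, cross_apply] <;> ring

/-- The Coriolis vector does not see the drift: `λ̄c = 2Ω ⇒ (2Ω) × c = 0`. -/
theorem cross_coriolis_drift_eq_zero {lam : ℝ} {c Ω : EuclideanSpace ℝ (Fin 3)}
    (hc : lam • c = (2 : ℝ) • Ω) : cross ((2 : ℝ) • Ω) c = 0 := by
  rw [← hc]
  ext i
  fin_cases i <;> simp [cross]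

/-! ### §2 INHERITED DRIFT LEMMA — the drifting Beltrami pattern is an exact solution with Coriolis force -/

/-- **INHERITED DRIFT LEMMA (rotating-frame form).** For a smooth divergence-free strong Beltrami
field `U` (`curl U = λ̄U`), a rotation vector `Ω` and a drift vector `c` with `λ̄c = 2Ω`, the
rigidly drifting pattern `u(t, x) = U(x + tc)` with `p = −½|u|² − ⟪c, u⟫` is a classical solution
of the Navier–Stokes system on `ℝ³ × ℝ` with force `νλ̄²u − 2Ω × u` (viscous maintenance plus the
Coriolis body force of the rotating frame). Mechanism: `∂ₜu = DU[c] = λ̄U × c + ∇⟪c, U⟫ =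
−2Ω × u + ∇⟪c, u⟫`, `(u·∇)u = ∇½|u|²`, `νΔu = −νλ̄²u`. -/
theorem isClassicalNSSolutionOn_driftingHost
    {U : EuclideanSpace ℝ (Fin 3) → EuclideanSpace ℝ (Fin 3)} {lam0 : ℝ} (ν : ℝ)
    {c Ω : EuclideanSpace ℝ (Fin 3)} (hc : lam0 • c = (2 : ℝ) • Ω)
    (hU : IsBeltrami U fun _ => lam0) (hUs : ContDiff ℝ ∞ U) (hUdiv : VectorCalculus.IsDivFree U) :
    IsClassicalNSSolutionOn univ ν
      (fun t x => (ν * lam0 ^ 2) • U (x + t • c) - cross ((2 : ℝ) • Ω) (U (x + t • c)))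
      (fun t x => U (x + t • c))
      (fun t x => -(‖U (x + t • c)‖ ^ 2 / 2) - ⟪c, U (x + t • c)⟫) := by
  have hUd : Differentiable ℝ U := hUs.differentiable (by simp)
  -- joint smoothness of the velocity
  have hsu : ContDiff ℝ ∞ (fun q : ℝ × EuclideanSpace ℝ (Fin 3) => U (q.2 + q.1 • c)) :=
    hUs.comp (contDiff_snd.add (contDiff_fst.smul contDiff_const))
  refine ⟨hsu.contDiffOn, ?_, ?_, ?_⟩
  · -- joint smoothness of the pressure
    exact ((((hsu.norm_sq ℝ).div_const 2).neg).sub (contDiff_const.inner ℝ hsu)).contDiffOn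
  · -- the momentum equation
    intro t _ x
    set s : EuclideanSpace ℝ (Fin 3) := t • c with hs
    have hUt : IsBeltrami (fun y => U (y + s)) fun _ => lam0 := hU.translate s
    have hUts : ContDiff ℝ ∞ (fun y => U (y + s)) := contDiff_translate hUs s
    have hUt2 : ContDiff ℝ 2 (fun y => U (y + s)) := contDiff_infty.1 hUts 2
    have hUtd : Differentiable ℝ (fun y => U (y + s)) := hUts.differentiable (by simp)
    have hUtdiv : VectorCalculus.IsDivFree (fun y => U (y + s)) := isDivFree_translate hUdiv s
    -- time derivative: `∂ₜ U(x + tc) = DU(x + tc)[c]`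
    have h1 : timeDerivWithin univ (fun r y => U (y + r • c)) t x = fderiv ℝ U (x + s) c := by
      rw [timeDerivWithin_apply, derivWithin_univ]
      have hin : HasDerivAt (fun r : ℝ => x + r • c) ((1 : ℝ) • c) t :=
        ((hasDerivAt_id t).smul_const c).const_add x
      have h := ((hUd (x + s)).hasFDerivAt).comp_hasDerivAt t hin
      rw [one_smul] at h
      exact h.deriv
    -- `DU(x + s)[c] = λ̄ U(x + s) × c + ∇⟪c, U(· + s)⟫(x)`
    have h1' : fderiv ℝ U (x + s) c =
        cross (lam0 • U (x + s)) c + gradient (fun y => ⟪c, U (y + s)⟫) x := by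
      have e1 : fderiv ℝ (fun y => U (y + s)) x c = fderiv ℝ U (x + s) c := by
        rw [fderiv_comp_add_right]
      rw [← e1, fderiv_apply_eq_cross_curl_add_gradient (hUtd x) c, hUt x]
    -- convective term
    have h2 : convect (fun y => U (y + s)) (fun y => U (y + s)) x =
        gradient (fun y => ‖U (y + s)‖ ^ 2 / 2) x := hUt.convect_eq_gradient (hUtd x)
    -- viscous term
    have h3 : Δ (fun y => U (y + s)) x = -(lam0 ^ 2) • U (x + s) :=
      laplacian_eq_of_strongBeltrami hUt hUt2 hUtdiv x
    -- pressure gradient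
    have h4 : gradient (fun y => -(‖U (y + s)‖ ^ 2 / 2) - ⟪c, U (y + s)⟫) x =
        -gradient (fun y => ‖U (y + s)‖ ^ 2 / 2) x - gradient (fun y => ⟪c, U (y + s)⟫) x := by
      have hd0 : DifferentiableAt ℝ (fun y => ‖U (y + s)‖ ^ 2 / 2) x :=
        (hasFDerivAt_half_norm_sq (hUtd x)).differentiableAt
      have hd1 : DifferentiableAt ℝ (fun y => -(‖U (y + s)‖ ^ 2 / 2)) x := hd0.neg
      have hd2 : DifferentiableAt ℝ (fun y => ⟪c, U (y + s)⟫) x :=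
        (differentiableAt_const c).inner ℝ (hUtd x)
      simp only [gradient, fderiv_fun_sub hd1 hd2, fderiv_fun_neg, map_sub, map_neg]
    -- Coriolis bookkeeping: `λ̄ U × c = −(λ̄c) × U = −(2Ω) × U`
    have h5 : cross (lam0 • U (x + s)) c = -cross ((2 : ℝ) • Ω) (U (x + s)) := by
      rw [cross_smul_left_eq_neg_cross_smul, hc]
    show timeDerivWithin univ (fun r y => U (y + r • c)) t x +
        convect (fun y => U (y + s)) (fun y => U (y + s)) x =
      ν • Δ (fun y => U (y + s)) x -
        gradient (fun y => -(‖U (y + s)‖ ^ 2 / 2) - ⟪c, U (y + s)⟫) x +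
        ((ν * lam0 ^ 2) • U (x + s) - cross ((2 : ℝ) • Ω) (U (x + s)))
    rw [h1, h1', h2, h3, h4, h5]
    ext i
    simp only [PiLp.add_apply, PiLp.sub_apply, PiLp.neg_apply, PiLp.smul_apply, smul_eq_mul]
    ring
  · -- incompressibility
    intro t _
    exact isDivFree_translate hUdiv (t • c)

/-- **Rotating Euler form** (`ν = 0`): the drifting Beltrami pattern `U(x + tc)`, `λ̄c = 2Ω`, is an
exact classical solution of the rotating (Coriolis-forced) Euler equations with force `−2Ω × u` —
the nonlinear inertial-wave translate. -/
theorem isClassicalEulerSolutionOn_driftingHost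
    {U : EuclideanSpace ℝ (Fin 3) → EuclideanSpace ℝ (Fin 3)} {lam0 : ℝ}
    {c Ω : EuclideanSpace ℝ (Fin 3)} (hc : lam0 • c = (2 : ℝ) • Ω)
    (hU : IsBeltrami U fun _ => lam0) (hUs : ContDiff ℝ ∞ U) (hUdiv : VectorCalculus.IsDivFree U) :
    IsClassicalEulerSolutionOn univ
      (fun t x => -cross ((2 : ℝ) • Ω) (U (x + t • c)))
      (fun t x => U (x + t • c))
      (fun t x => -(‖U (x + t • c)‖ ^ 2 / 2) - ⟪c, U (x + t • c)⟫) := by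
  have h := isClassicalNSSolutionOn_driftingHost 0 hc hU hUs hUdiv
  simp only [zero_mul, zero_smul, zero_sub] at h
  exact h

/-- **ABC instance.** For the ABC pattern (`λ̄ = 1`) in background rotation `Ω` the drift is
`c = 2Ω`: `abc A B C (x + 2tΩ)` solves the Coriolis-forced system exactly. -/
theorem isClassicalNSSolutionOn_abc_drifting (ν A B C : ℝ) (Ω : EuclideanSpace ℝ (Fin 3)) :
    IsClassicalNSSolutionOn univ ν
      (fun t x => ν • abc A B C (x + t • ((2 : ℝ) • Ω)) -
        cross ((2 : ℝ) • Ω) (abc A B C (x + t • ((2 : ℝ) • Ω))))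
      (fun t x => abc A B C (x + t • ((2 : ℝ) • Ω)))
      (fun t x => -(‖abc A B C (x + t • ((2 : ℝ) • Ω))‖ ^ 2 / 2) -
        ⟪(2 : ℝ) • Ω, abc A B C (x + t • ((2 : ℝ) • Ω))⟫) := by
  have hc : (1 : ℝ) • ((2 : ℝ) • Ω) = (2 : ℝ) • Ω := one_smul _ _
  have h := isClassicalNSSolutionOn_driftingHost ν hc (isBeltrami_abc A B C) (contDiff_abc A B C)
    (isDivFree_abc A B C)
  simp only [one_pow, mul_one] at h
  exact h

/-! ### §3 The co-moving form: steady pattern, absolute vorticity `= λ̄ ×` co-moving velocity -/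

/-- **Absolute vorticity of the drifting pattern.** At every time and point,
`curl u + 2Ω = λ̄ (u + c)`: the absolute vorticity (relative vorticity plus the background `2Ω`)
is `λ̄` times the velocity measured in the frame of the drifting pattern (`u + c`, since the pattern
moves with velocity `−c`). In that frame the flow is steady, so absolute vortex lines are the
streamlines of the steady co-moving flow `V = U + c` — the hypothesis of the steady-host tangency
lemma K21 / R12′ (absolute vorticity vanishes at the co-moving stagnation points and is tangent to
their invariant manifolds). -/
theorem absoluteVorticity_eq_smul_comovingVelocity
    {U : EuclideanSpace ℝ (Fin 3) → EuclideanSpace ℝ (Fin 3)} {lam0 : ℝ}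
    {c Ω : EuclideanSpace ℝ (Fin 3)} (hc : lam0 • c = (2 : ℝ) • Ω)
    (hU : IsBeltrami U fun _ => lam0) (t : ℝ) (x : EuclideanSpace ℝ (Fin 3)) :
    curl (fun y => U (y + t • c)) x + (2 : ℝ) • Ω = lam0 • (U (x + t • c) + c) := by
  rw [(hU.translate (t • c)) x, ← hc, smul_add]

/-- **INHERITED DRIFT LEMMA, co-moving form.** Boosting `isClassicalNSSolutionOn_driftingHost`
into the frame of the pattern (the tree's `galileanBoost`, frame path `ξ(t) = −tc`, gauge `0`)
gives the classical solution with velocity `U(y) − d/dt(−tc) = U(y) + c` — the STEADY Beltrami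
pattern plus the uniform drift — with force `νλ̄²U(y) − 2Ω × U(y)` and pressure
`−½|U(y)|² − ⟪c, U(y)⟫ + ⟪ξ'', y⟫ − 0`. Since `2Ω × c = 0` (`cross_coriolis_drift_eq_zero`) the
force equals `νλ̄²U − 2Ω × (U + c)`: the co-moving system is again the Coriolis-forced one, now
about a steady velocity whose absolute vorticity is `λ̄(U + c)`
(`absoluteVorticity_eq_smul_comovingVelocity`). -/
theorem isClassicalNSSolutionOn_driftingHost_comoving
    {U : EuclideanSpace ℝ (Fin 3) → EuclideanSpace ℝ (Fin 3)} {lam0 : ℝ} (ν : ℝ)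
    {c Ω : EuclideanSpace ℝ (Fin 3)} (hc : lam0 • c = (2 : ℝ) • Ω)
    (hU : IsBeltrami U fun _ => lam0) (hUs : ContDiff ℝ ∞ U) (hUdiv : VectorCalculus.IsDivFree U) :
    IsClassicalNSSolutionOn univ ν
      (fun _ y => (ν * lam0 ^ 2) • U y - cross ((2 : ℝ) • Ω) (U y))
      (fun t y => U y - deriv (fun r : ℝ => -(r • c)) t)
      (fun t y => -(‖U y‖ ^ 2 / 2) - ⟪c, U y⟫ + ⟪deriv (deriv (fun r : ℝ => -(r • c))) t, y⟫ - 0) := by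
  have h0 := isClassicalNSSolutionOn_driftingHost ν hc hU hUs hUdiv
  have hξ : ContDiff ℝ ∞ (fun r : ℝ => -(r • c)) := (contDiff_id.smul contDiff_const).neg
  have key := h0.galileanBoost uniqueDiffOn_univ hξ (g := fun _ => (0 : ℝ)) contDiff_const
  have hsimp : ∀ (t : ℝ) (y : EuclideanSpace ℝ (Fin 3)), y + -(t • c) + t • c = y :=
    fun t y => by rw [add_assoc, neg_add_cancel, add_zero]
  simp only [hsimp] at key
  exact key

/-- The co-moving velocity made explicit: `U(y) − d/dt(−tc) = U(y) + c`. -/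
theorem comoving_velocity_eq (U : EuclideanSpace ℝ (Fin 3) → EuclideanSpace ℝ (Fin 3))
    (c y : EuclideanSpace ℝ (Fin 3)) (t : ℝ) :
    U y - deriv (fun r : ℝ => -(r • c)) t = U y + c := by
  have h : HasDerivAt (fun r : ℝ => -(r • c)) (-((1 : ℝ) • c)) t :=
    ((hasDerivAt_id t).smul_const c).neg
  rw [h.deriv, one_smul, sub_neg_eq_add]

/-- The co-moving force rewritten about the co-moving velocity: `νλ̄²U − 2Ω × U =
νλ̄²U − 2Ω × (U + c)` because `2Ω × c = 0`. -/
theorem comoving_force_eq {lam0 : ℝ} (ν : ℝ) {c Ω : EuclideanSpace ℝ (Fin 3)}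
    (hc : lam0 • c = (2 : ℝ) • Ω) (v : EuclideanSpace ℝ (Fin 3)) :
    (ν * lam0 ^ 2) • v - cross ((2 : ℝ) • Ω) v =
      (ν * lam0 ^ 2) • v - cross ((2 : ℝ) • Ω) (v + c) := by
  have h0 := cross_coriolis_drift_eq_zero hc
  have hadd : cross ((2 : ℝ) • Ω) (v + c) = cross ((2 : ℝ) • Ω) v + cross ((2 : ℝ) • Ω) c := by
    ext i
    fin_cases i <;> simp [cross, cross_apply] <;> ring
  rw [hadd, h0, add_zero]

end Summit.NavierStokesRegularity.FluidComputer.InheritedDriftBeltramiHost
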